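import Mathlib
import Literature.NumberTheory.Sieve.Maynard2016Lemma6CountingProof
import Literature.NumberTheory.Sieve.Maynard2016LamSupport
import HarnessLib

/-!
# Maynard (2016), Lemma 7: expansion of the square over `q` — display (6.27), the "link" identity

Trunk: AntSieve / parity (Maynard 2016 large-gaps ladder; named fact
`Literature.NumberTheory.Sieve.Maynard2016.Lemma7Tuple` of `Maynard2016Lemma7PerTuple.lean`, the
last named input of `Maynard2016_theorem1` after `maynard2016_lemma6_holds`).

J. Maynard, *Large gaps between primes*, Ann. of Math. 183 (2016) = arXiv:1408.5110, §6, proof of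
Lemma 7, displays (6.26)–(6.27).  After dropping all `n` except `n = p₀ − h_i q` ((6.23)) one faces,
for a set `Q` of primes `q` (an interval `𝓘_m`, a class `w₀ (mod P_w)`, the constraints
`a_{i,j} ∣ m q (h_i − h_j) − 1` — all of them conditions on `q` alone),

`Σ_{q ∈ Q} ( Σ_{d_ℓ ∣ n_q + h_ℓ q} Σ_{e_ℓ ∣ m(n_q + h_ℓ q) − 1} λ_{d,e} )²`,  `n_q = p₀ − h_i q`.

"Since `p₀` is a prime larger than `x`, and `(m p₀ − 1, P_y) = 1`, we may restrict to
`d_i = e_i = 1` … Inserting this condition, expanding the square and swapping the order of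
summation then gives that the sum over `q` is equal to
`Σ_{d,d' (d_i = d'_i = 1)} Σ_{e,e' (e_i = e'_i = 1)} λ_{d,e} λ_{d',e'} · #{q ∈ Q : [d_ℓ,d'_ℓ] ∣ n_q + h_ℓ q,
[e_ℓ,e'_ℓ] ∣ m(n_q + h_ℓ q) − 1 ∀ ℓ}`" ((6.27)).

This file PROVES exactly that, over the `q`-independent index box `[1,x]^k` of
`Maynard2016Lemma6Split.box` (all `λ_{d,e} ≠ 0` have `d_ℓ, e_ℓ ≤ x`, `Lemma6CountingProof`):
* `sum_divSum_sq_eq_sum_box` — the expansion of the square for a general finite set `Q` of moduli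
  `q ≥ 1` and a general argument `n_q ≥ 1` (the `q`-sum analogue of `normInv_eq_sum_box`, (6.2));
* `divSum_sub_eq_sum_rbox` — at `n_q = p₀ − h_i q` with `p₀ > x` prime and `(m p₀ − 1, P_y) = 1`
  the box may be replaced by `rbox k x i = {d ∈ [1,x]^k : d_i = 1}` on both the `d`- and the
  `e`-side ((6.26); the `d`-side uses only `d_i ≤ x < p₀`, the `e`-side the support `e_i ≤ y` of
  `λ` and the coprimality with `P_y`, `Maynard2016LamSupport.apply_eq_one_of_lam_ne_zero`);
* `sum_divSum_sub_sq_eq_sum_rbox` — (6.27) itself;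
* `cast_sub_add_hTuple_mul` — the arguments are linear in `q`: `n_q + h_ℓ q = p₀ + (h_ℓ − h_i) q`
  in `ℤ`, the form in which the conditions are residue classes for `q` ((6.27), last display of
  p. 11).

## References

* J. Maynard, *Large gaps between primes*, Ann. of Math. (2) 183 (2016), 915–933; arXiv:1408.5110,
  §6, proof of Lemma 7, displays (6.26)–(6.27). [Maynard2016LargeGaps]
-/

open Finset
open scoped BigOperators

namespace Literature.NumberTheory.Sieve

namespace Maynard2016

/-! ### (6.2) with `q` summed: expansion of the square over a set of moduli -/

/-- **Expansion of the square over `q`** (the `q`-sum analogue of (6.2)): for a finite set `Q` of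
moduli `q ≥ 1` and arguments `n_q ≥ 1`,
`Σ_{q ∈ Q} (Σ_{d,e} λ_{d,e})² = Σ_{d,d',e,e' ∈ [1,x]^k} λ_{d,e} λ_{d',e'} · #{q ∈ Q : [d_j,d'_j] ∣ n_q + h_j q,
[e_j,e'_j] ∣ m(n_q + h_j q) − 1 ∀ j}`. [cite: Maynard2016LargeGaps, Lemma 7 (proof, display (6.27))] -/
theorem sum_divSum_sq_eq_sum_box {k J : ℕ} {c : Fin J → ℝ} {Fd : Fin k → Fin J → ℝ → ℝ} {G : ℝ → ℝ}
    (hD : IsSieveData k J c Fd G) {ε : ℝ} {x : ℕ} (hx1 : 1 ≤ x) (hlogx : 0 < Real.log x)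
    (hlogy : 0 < Real.log (y ε x)) (hyx : y ε x ≤ x) {m : ℕ} (hm : 1 ≤ m) (Q : Finset ℕ)
    (n : ℕ → ℕ) (hQ : ∀ q ∈ Q, 0 < q ∧ 1 ≤ n q) :
    ∑ q ∈ Q, divSum c Fd G ε x m q (n q) ^ 2 =
      ∑ d ∈ box k x, ∑ d' ∈ box k x, ∑ e ∈ box k x, ∑ e' ∈ box k x,
        lam c Fd G ε x d e * lam c Fd G ε x d' e' *
          (((Q.filter (fun q => ∀ j ∈ (Finset.univ : Finset (Fin k)),
              Nat.lcm (d j) (d' j) ∣ n q + hTuple k x j * q ∧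
                Nat.lcm (e j) (e' j) ∣ m * (n q + hTuple k x j * q) - 1)).card : ℕ) : ℝ) := by
  classical
  have hstep : ∀ q ∈ Q, divSum c Fd G ε x m q (n q) ^ 2 =
      ∑ d ∈ box k x, ∑ d' ∈ box k x, ∑ e ∈ box k x, ∑ e' ∈ box k x,
        (if (∀ i, d i ∣ n q + hTuple k x i * q) ∧ (∀ i, e i ∣ m * (n q + hTuple k x i * q) - 1)
          then lam c Fd G ε x d e else 0) *
        (if (∀ i, d' i ∣ n q + hTuple k x i * q) ∧ (∀ i, e' i ∣ m * (n q + hTuple k x i * q) - 1)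
          then lam c Fd G ε x d' e' else 0) := by
    intro q hq
    rw [divSum_eq_sum_box hD hx1 hlogx hlogy hyx hm (hQ q hq).1 (hQ q hq).2, sq, Finset.sum_mul_sum]
    refine Finset.sum_congr rfl fun d _ => Finset.sum_congr rfl fun d' _ => ?_
    rw [Finset.sum_mul_sum]
  rw [Finset.sum_congr rfl hstep, Finset.sum_comm]
  refine Finset.sum_congr rfl fun d _ => ?_
  rw [Finset.sum_comm]
  refine Finset.sum_congr rfl fun d' _ => ?_
  rw [Finset.sum_comm]
  refine Finset.sum_congr rfl fun e _ => ?_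
  rw [Finset.sum_comm]
  refine Finset.sum_congr rfl fun e' _ => ?_
  have hterm : ∀ q ∈ Q,
      (if (∀ i, d i ∣ n q + hTuple k x i * q) ∧ (∀ i, e i ∣ m * (n q + hTuple k x i * q) - 1)
          then lam c Fd G ε x d e else 0) *
        (if (∀ i, d' i ∣ n q + hTuple k x i * q) ∧ (∀ i, e' i ∣ m * (n q + hTuple k x i * q) - 1)
          then lam c Fd G ε x d' e' else 0) =
      if (∀ j ∈ (Finset.univ : Finset (Fin k)), Nat.lcm (d j) (d' j) ∣ n q + hTuple k x j * q ∧
          Nat.lcm (e j) (e' j) ∣ m * (n q + hTuple k x j * q) - 1)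
        then lam c Fd G ε x d e * lam c Fd G ε x d' e' else 0 := by
    intro q _
    have hiff : ((∀ i, d i ∣ n q + hTuple k x i * q) ∧
        (∀ i, e i ∣ m * (n q + hTuple k x i * q) - 1)) ∧
        ((∀ i, d' i ∣ n q + hTuple k x i * q) ∧
        (∀ i, e' i ∣ m * (n q + hTuple k x i * q) - 1)) ↔
        (∀ j ∈ (Finset.univ : Finset (Fin k)), Nat.lcm (d j) (d' j) ∣ n q + hTuple k x j * q ∧
          Nat.lcm (e j) (e' j) ∣ m * (n q + hTuple k x j * q) - 1) := by
      simp only [Finset.mem_univ, true_implies, Nat.lcm_dvd_iff]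
      exact ⟨fun h j => ⟨⟨h.1.1 j, h.2.1 j⟩, ⟨h.1.2 j, h.2.2 j⟩⟩,
        fun h => ⟨⟨fun j => (h j).1.1, fun j => (h j).2.1⟩, ⟨fun j => (h j).1.2, fun j => (h j).2.2⟩⟩⟩
    by_cases h1 : (∀ i, d i ∣ n q + hTuple k x i * q) ∧
        (∀ i, e i ∣ m * (n q + hTuple k x i * q) - 1)
    · by_cases h2 : (∀ i, d' i ∣ n q + hTuple k x i * q) ∧
        (∀ i, e' i ∣ m * (n q + hTuple k x i * q) - 1)
      · rw [if_pos h1, if_pos h2, if_pos (hiff.1 ⟨h1, h2⟩)]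
      · rw [if_pos h1, if_neg h2, if_neg (fun h => h2 (hiff.2 h).2), mul_zero]
    · rw [if_neg h1, zero_mul, if_neg (fun h => h1 (hiff.2 h).1)]
  rw [Finset.sum_congr rfl hterm, ← Finset.sum_filter, Finset.sum_const, nsmul_eq_mul, mul_comm]

/-! ### (6.26): the restricted box `d_i = 1` -/

/-- The restricted box `{d ∈ [1,X]^k : d_i = 1}` ("we may restrict to `d_k = e_k = 1`").
[cite: Maynard2016LargeGaps, Lemma 7 (proof, display (6.26))] -/
def rbox (k X : ℕ) (i : Fin k) : Finset (Fin k → ℕ) := (box k X).filter (fun d => d i = 1)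

/-- Membership in `rbox`. [cite: Maynard2016LargeGaps, Lemma 7 (proof, display (6.26))] -/
theorem mem_rbox {k X : ℕ} {i : Fin k} {d : Fin k → ℕ} :
    d ∈ rbox k X i ↔ d ∈ box k X ∧ d i = 1 := Finset.mem_filter

/-- `rbox ⊆ box`. [cite: Maynard2016LargeGaps, Lemma 7 (proof, display (6.26))] -/
theorem rbox_subset_box (k X : ℕ) (i : Fin k) : rbox k X i ⊆ box k X := Finset.filter_subset _ _

/-- Coordinates of a box element lie in `[1, X]`. [folklore] -/
private theorem mem_box_iff {k X : ℕ} {d : Fin k → ℕ} :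
    d ∈ box k X ↔ ∀ ℓ, 1 ≤ d ℓ ∧ d ℓ ≤ X := by
  simp only [box, Fintype.mem_piFinset, Finset.mem_Icc]

/-- **The arguments are linear in `q`:** with `h_i q ≤ p₀`,
`((p₀ − h_i q) + h_ℓ q : ℤ) = p₀ + (h_ℓ − h_i) q`. [cite: Maynard2016LargeGaps, Lemma 7 (proof, display (6.27))] -/
theorem cast_sub_add_hTuple_mul {k x : ℕ} {i : Fin k} (ℓ : Fin k) {q p₀ : ℕ}
    (hle : hTuple k x i * q ≤ p₀) :
    ((p₀ - hTuple k x i * q + hTuple k x ℓ * q : ℕ) : ℤ) =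
      (p₀ : ℤ) + ((hTuple k x ℓ : ℤ) - hTuple k x i) * q := by
  push_cast [Nat.cast_sub hle]
  ring

/-- At `ℓ = i` the argument is `p₀` itself. [cite: Maynard2016LargeGaps, Lemma 7 (proof, display (6.26))] -/
theorem sub_add_hTuple_mul_self {k x : ℕ} (i : Fin k) {q p₀ : ℕ} (hle : hTuple k x i * q ≤ p₀) :
    p₀ - hTuple k x i * q + hTuple k x i * q = p₀ := Nat.sub_add_cancel hle

/-- **(6.26): restriction to `d_i = e_i = 1`, box form.**  For `p₀ > x` prime with
`(m p₀ − 1, P_y) = 1`, `m ≥ 1`, `q ≥ 1`, `h_i q < p₀`, the divisor sum at `n = p₀ − h_i q` equals the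
indicator sum over `rbox × rbox`. [cite: Maynard2016LargeGaps, Lemma 7 (proof, display (6.26))] -/
theorem divSum_sub_eq_sum_rbox {k J : ℕ} {c : Fin J → ℝ} {Fd : Fin k → Fin J → ℝ → ℝ} {G : ℝ → ℝ}
    (hD : IsSieveData k J c Fd G) {ε : ℝ} {x : ℕ} (hx1 : 1 ≤ x) (hlogx : 0 < Real.log x)
    (hlogy : 0 < Real.log (y ε x)) (hyx : y ε x ≤ x) {m q p₀ : ℕ} (hm : 1 ≤ m) (hq : 0 < q)
    (hp₀ : p₀.Prime) (hxp : x < p₀) (hcop : Nat.Coprime (m * p₀ - 1) (primorial ⌊y ε x⌋₊))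
    {i : Fin k} (hlt : hTuple k x i * q < p₀) :
    divSum c Fd G ε x m q (p₀ - hTuple k x i * q) = ∑ d ∈ rbox k x i, ∑ e ∈ rbox k x i,
      if (∀ ℓ, d ℓ ∣ p₀ - hTuple k x i * q + hTuple k x ℓ * q) ∧
          (∀ ℓ, e ℓ ∣ m * (p₀ - hTuple k x i * q + hTuple k x ℓ * q) - 1)
        then lam c Fd G ε x d e else 0 := by
  classical
  have hn1 : 1 ≤ p₀ - hTuple k x i * q := by omega
  have hself : p₀ - hTuple k x i * q + hTuple k x i * q = p₀ := Nat.sub_add_cancel hlt.le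
  have hN0 : m * p₀ - 1 ≠ 0 := by
    have : 2 ≤ m * p₀ := le_trans hp₀.two_le (Nat.le_mul_of_pos_left _ (by omega))
    omega
  rw [divSum_eq_sum_box hD hx1 hlogx hlogy hyx hm hq hn1]
  symm
  -- the `e`-side: terms with `e i ≠ 1` vanish (`e i ∣ m p₀ − 1`, support `e i ≤ y`, `(m p₀ − 1, P_y) = 1`)
  have hA : ∀ d : Fin k → ℕ,
      (∑ e ∈ rbox k x i,
        if (∀ ℓ, d ℓ ∣ p₀ - hTuple k x i * q + hTuple k x ℓ * q) ∧
            (∀ ℓ, e ℓ ∣ m * (p₀ - hTuple k x i * q + hTuple k x ℓ * q) - 1)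
          then lam c Fd G ε x d e else 0) =
      ∑ e ∈ box k x,
        if (∀ ℓ, d ℓ ∣ p₀ - hTuple k x i * q + hTuple k x ℓ * q) ∧
            (∀ ℓ, e ℓ ∣ m * (p₀ - hTuple k x i * q + hTuple k x ℓ * q) - 1)
          then lam c Fd G ε x d e else 0 := by
    intro d
    refine Finset.sum_subset (rbox_subset_box k x i) fun e he hne => ?_
    have hei : e i ≠ 1 := fun h => hne (mem_rbox.2 ⟨he, h⟩)
    by_cases hcond : (∀ ℓ, d ℓ ∣ p₀ - hTuple k x i * q + hTuple k x ℓ * q) ∧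
        (∀ ℓ, e ℓ ∣ m * (p₀ - hTuple k x i * q + hTuple k x ℓ * q) - 1)
    · rw [if_pos hcond]
      by_contra hlam
      have hdiv : e i ∣ m * p₀ - 1 := by
        have := hcond.2 i
        rwa [hself] at this
      exact hei (apply_eq_one_of_lam_ne_zero hD hlogy hN0 hcop hdiv hlam)
    · rw [if_neg hcond]
  rw [Finset.sum_congr rfl fun d _ => hA d]
  -- the `d`-side: terms with `d i ≠ 1` vanish since `d i ∣ p₀`, `d i ≤ x < p₀`
  refine Finset.sum_subset (rbox_subset_box k x i) fun d hd hnd => ?_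
  have hdi : d i ≠ 1 := fun h => hnd (mem_rbox.2 ⟨hd, h⟩)
  refine Finset.sum_eq_zero fun e _ => ?_
  rw [if_neg]
  rintro ⟨hdcond, -⟩
  have hdiv : d i ∣ p₀ := by
    have := hdcond i
    rwa [hself] at this
  have hle : d i ≤ x := ((mem_box_iff.1 hd) i).2
  rcases (Nat.dvd_prime hp₀).1 hdiv with h | h
  · exact hdi h
  · omega

/-- **(6.27): the sum over `q` after the restriction and the expansion of the square.**  For a finite
set `Q` of moduli `q ≥ 1` with `h_i q < p₀` (`p₀ > x` prime, `(m p₀ − 1, P_y) = 1`, `m ≥ 1`):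
`Σ_{q ∈ Q} (Σ_{d,e} λ_{d,e})²|_{n = p₀ − h_i q} = Σ_{d,d',e,e' ∈ rbox} λ_{d,e} λ_{d',e'} ·
#{q ∈ Q : [d_ℓ,d'_ℓ] ∣ (p₀ − h_i q) + h_ℓ q, [e_ℓ,e'_ℓ] ∣ m((p₀ − h_i q) + h_ℓ q) − 1 ∀ ℓ}`.
[cite: Maynard2016LargeGaps, Lemma 7 (proof, display (6.27))] -/
theorem sum_divSum_sub_sq_eq_sum_rbox {k J : ℕ} {c : Fin J → ℝ} {Fd : Fin k → Fin J → ℝ → ℝ}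
    {G : ℝ → ℝ} (hD : IsSieveData k J c Fd G) {ε : ℝ} {x : ℕ} (hx1 : 1 ≤ x)
    (hlogx : 0 < Real.log x) (hlogy : 0 < Real.log (y ε x)) (hyx : y ε x ≤ x) {m p₀ : ℕ}
    (hm : 1 ≤ m) (hp₀ : p₀.Prime) (hxp : x < p₀)
    (hcop : Nat.Coprime (m * p₀ - 1) (primorial ⌊y ε x⌋₊)) {i : Fin k} (Q : Finset ℕ)
    (hQ : ∀ q ∈ Q, 0 < q ∧ hTuple k x i * q < p₀) :
    ∑ q ∈ Q, divSum c Fd G ε x m q (p₀ - hTuple k x i * q) ^ 2 =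
      ∑ d ∈ rbox k x i, ∑ d' ∈ rbox k x i, ∑ e ∈ rbox k x i, ∑ e' ∈ rbox k x i,
        lam c Fd G ε x d e * lam c Fd G ε x d' e' *
          (((Q.filter (fun q => ∀ j ∈ (Finset.univ : Finset (Fin k)),
              Nat.lcm (d j) (d' j) ∣ p₀ - hTuple k x i * q + hTuple k x j * q ∧
                Nat.lcm (e j) (e' j) ∣ m * (p₀ - hTuple k x i * q + hTuple k x j * q) - 1)).card :
            ℕ) : ℝ) := by
  classical
  have hstep : ∀ q ∈ Q, divSum c Fd G ε x m q (p₀ - hTuple k x i * q) ^ 2 =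
      ∑ d ∈ rbox k x i, ∑ d' ∈ rbox k x i, ∑ e ∈ rbox k x i, ∑ e' ∈ rbox k x i,
        (if (∀ ℓ, d ℓ ∣ p₀ - hTuple k x i * q + hTuple k x ℓ * q) ∧
            (∀ ℓ, e ℓ ∣ m * (p₀ - hTuple k x i * q + hTuple k x ℓ * q) - 1)
          then lam c Fd G ε x d e else 0) *
        (if (∀ ℓ, d' ℓ ∣ p₀ - hTuple k x i * q + hTuple k x ℓ * q) ∧
            (∀ ℓ, e' ℓ ∣ m * (p₀ - hTuple k x i * q + hTuple k x ℓ * q) - 1)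
          then lam c Fd G ε x d' e' else 0) := by
    intro q hq
    rw [divSum_sub_eq_sum_rbox hD hx1 hlogx hlogy hyx hm (hQ q hq).1 hp₀ hxp hcop (hQ q hq).2, sq,
      Finset.sum_mul_sum]
    refine Finset.sum_congr rfl fun d _ => Finset.sum_congr rfl fun d' _ => ?_
    rw [Finset.sum_mul_sum]
  rw [Finset.sum_congr rfl hstep, Finset.sum_comm]
  refine Finset.sum_congr rfl fun d _ => ?_
  rw [Finset.sum_comm]
  refine Finset.sum_congr rfl fun d' _ => ?_
  rw [Finset.sum_comm]
  refine Finset.sum_congr rfl fun e _ => ?_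
  rw [Finset.sum_comm]
  refine Finset.sum_congr rfl fun e' _ => ?_
  have hterm : ∀ q ∈ Q,
      (if (∀ ℓ, d ℓ ∣ p₀ - hTuple k x i * q + hTuple k x ℓ * q) ∧
          (∀ ℓ, e ℓ ∣ m * (p₀ - hTuple k x i * q + hTuple k x ℓ * q) - 1)
          then lam c Fd G ε x d e else 0) *
        (if (∀ ℓ, d' ℓ ∣ p₀ - hTuple k x i * q + hTuple k x ℓ * q) ∧
            (∀ ℓ, e' ℓ ∣ m * (p₀ - hTuple k x i * q + hTuple k x ℓ * q) - 1)
          then lam c Fd G ε x d' e' else 0) =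
      if (∀ j ∈ (Finset.univ : Finset (Fin k)),
          Nat.lcm (d j) (d' j) ∣ p₀ - hTuple k x i * q + hTuple k x j * q ∧
            Nat.lcm (e j) (e' j) ∣ m * (p₀ - hTuple k x i * q + hTuple k x j * q) - 1)
        then lam c Fd G ε x d e * lam c Fd G ε x d' e' else 0 := by
    intro q _
    have hiff : ((∀ ℓ, d ℓ ∣ p₀ - hTuple k x i * q + hTuple k x ℓ * q) ∧
        (∀ ℓ, e ℓ ∣ m * (p₀ - hTuple k x i * q + hTuple k x ℓ * q) - 1)) ∧
        ((∀ ℓ, d' ℓ ∣ p₀ - hTuple k x i * q + hTuple k x ℓ * q) ∧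
        (∀ ℓ, e' ℓ ∣ m * (p₀ - hTuple k x i * q + hTuple k x ℓ * q) - 1)) ↔
        (∀ j ∈ (Finset.univ : Finset (Fin k)),
          Nat.lcm (d j) (d' j) ∣ p₀ - hTuple k x i * q + hTuple k x j * q ∧
            Nat.lcm (e j) (e' j) ∣ m * (p₀ - hTuple k x i * q + hTuple k x j * q) - 1) := by
      simp only [Finset.mem_univ, true_implies, Nat.lcm_dvd_iff]
      exact ⟨fun h j => ⟨⟨h.1.1 j, h.2.1 j⟩, ⟨h.1.2 j, h.2.2 j⟩⟩,
        fun h => ⟨⟨fun j => (h j).1.1, fun j => (h j).2.1⟩, ⟨fun j => (h j).1.2, fun j => (h j).2.2⟩⟩⟩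
    by_cases h1 : (∀ ℓ, d ℓ ∣ p₀ - hTuple k x i * q + hTuple k x ℓ * q) ∧
        (∀ ℓ, e ℓ ∣ m * (p₀ - hTuple k x i * q + hTuple k x ℓ * q) - 1)
    · by_cases h2 : (∀ ℓ, d' ℓ ∣ p₀ - hTuple k x i * q + hTuple k x ℓ * q) ∧
          (∀ ℓ, e' ℓ ∣ m * (p₀ - hTuple k x i * q + hTuple k x ℓ * q) - 1)
      · rw [if_pos h1, if_pos h2, if_pos (hiff.1 ⟨h1, h2⟩)]
      · rw [if_pos h1, if_neg h2, if_neg (fun h => h2 (hiff.2 h).2), mul_zero]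
    · rw [if_neg h1, zero_mul, if_neg (fun h => h1 (hiff.2 h).1)]
  rw [Finset.sum_congr rfl hterm, ← Finset.sum_filter, Finset.sum_const, nsmul_eq_mul, mul_comm]

/-- **The Lemma-7 instance:** `Q ⊆` the primes of `[A, B]` with `B ≤ x` (any further condition on `q`
— the class `w₀ (mod P_w)`, the constraints `a_{i,j} ∣ m q(h_i − h_j) − 1` — is a sub-filter `P`),
`p₀` with `h_i x < p₀` for all `i`, as in `Lemma7Tuple`. [cite: Maynard2016LargeGaps, Lemma 7 (proof, display (6.27))] -/
theorem sum_filter_intervalPrimes_divSum_sq_eq {k J : ℕ} {c : Fin J → ℝ}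
    {Fd : Fin k → Fin J → ℝ → ℝ} {G : ℝ → ℝ} (hD : IsSieveData k J c Fd G) {ε : ℝ} {x : ℕ}
    (hx1 : 1 ≤ x) (hlogx : 0 < Real.log x) (hlogy : 0 < Real.log (y ε x)) (hyx : y ε x ≤ x)
    {m p₀ : ℕ} (hm : 1 ≤ m) (hp₀ : p₀.Prime) (hcop : Nat.Coprime (m * p₀ - 1) (primorial ⌊y ε x⌋₊))
    {i : Fin k} (hbig : (hTuple k x i : ℝ) * x < p₀) {A B : ℝ} (hBx : B ≤ x)
    (P : ℕ → Prop) [DecidablePred P] :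
    ∑ q ∈ (intervalPrimes A B).filter P, divSum c Fd G ε x m q (p₀ - hTuple k x i * q) ^ 2 =
      ∑ d ∈ rbox k x i, ∑ d' ∈ rbox k x i, ∑ e ∈ rbox k x i, ∑ e' ∈ rbox k x i,
        lam c Fd G ε x d e * lam c Fd G ε x d' e' *
          (((((intervalPrimes A B).filter P).filter (fun q => ∀ j ∈ (Finset.univ : Finset (Fin k)),
              Nat.lcm (d j) (d' j) ∣ p₀ - hTuple k x i * q + hTuple k x j * q ∧
                Nat.lcm (e j) (e' j) ∣ m * (p₀ - hTuple k x i * q + hTuple k x j * q) - 1)).card :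
            ℕ) : ℝ) := by
  classical
  have hxp : x < p₀ := by
    have h1 : (1 : ℝ) ≤ hTuple k x i := by exact_mod_cast hTuple_pos k x i
    have h2 : (x : ℝ) ≤ hTuple k x i * x := le_mul_of_one_le_left (Nat.cast_nonneg _) h1
    exact_mod_cast h2.trans_lt hbig
  refine sum_divSum_sub_sq_eq_sum_rbox hD hx1 hlogx hlogy hyx hm hp₀ hxp hcop _ fun q hq => ?_
  obtain ⟨hq, -⟩ := Finset.mem_filter.1 hq
  simp only [intervalPrimes, Finset.mem_filter, Finset.mem_Icc] at hq
  refine ⟨hq.2.pos, ?_⟩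
  have hqx : q ≤ x := by
    have h1 : ⌊B⌋₊ ≤ ⌊((x : ℕ) : ℝ)⌋₊ := Nat.floor_le_floor hBx
    rw [Nat.floor_natCast] at h1
    exact hq.1.2.trans h1
  have : (hTuple k x i * q : ℝ) ≤ hTuple k x i * x := by
    exact mul_le_mul_of_nonneg_left (by exact_mod_cast hqx) (Nat.cast_nonneg _)
  exact_mod_cast this.trans_lt hbig

end Maynard2016

end Literature.NumberTheory.Sieve
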